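import Mathlib.RingTheory.NoetherNormalization
import Mathlib.RingTheory.KrullDimension.Polynomial
import Mathlib.RingTheory.KrullDimension.NonZeroDivisors
import Mathlib.RingTheory.KrullDimension.Field
import Mathlib.RingTheory.Ideal.GoingUp
import Mathlib.RingTheory.AlgebraicIndependent.TranscendenceBasis
import HarnessLib

/-!
# Krull dimension of affine domains equals transcendence degree

Standard commutative algebra, proved here because Mathlib (this pin) stops at Noether
normalization (`exists_integral_inj_algHom_of_fg`), the dimension of polynomial rings
(`MvPolynomial.ringKrullDim_of_isNoetherianRing`) and going-up / incomparability for a single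
step (`Ideal.exists_ideal_over_prime_of_isIntegral`, `Ideal.IsIntegral.comap_lt_comap`; the
going-up theorem "with arbitrary length chains" is a recorded TODO there):

* `Literature.RingTheory.KrullDimension.ringKrullDim_le_of_isIntegral` — for an integral algebra `R → S`, `dim S ≤ dim R`
  (incomparability);
* `Literature.RingTheory.KrullDimension.exists_ltSeries_of_isIntegral` — going-up for chains: every chain of primes of `R` lifts
  to a chain of primes of `S` of the same length (when `R → S` is injective and integral);
* `Literature.RingTheory.KrullDimension.ringKrullDim_eq_of_isIntegral` — hence `dim R = dim S`
  (Matsumura, *Commutative Ring Theory*, Thm 9.4 / Ex. 9.2; Eisenbud, Prop. 9.2);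
* `Literature.RingTheory.KrullDimension.exists_ringKrullDim_eq_and_trdeg_eq`, `Literature.RingTheory.KrullDimension.ringKrullDim_eq_trdeg` — for a domain `A`
  finitely generated over a field `F`, `dim A = trdeg_F A` is a natural number (Noether
  normalization: `A` is integral over a polynomial ring `F[x₁, …, x_s]` on algebraically
  independent `xᵢ`, which form a transcendence basis) (Matsumura, Thm 5.6; Eisenbud, Thm A,
  Cor. 13.4);
* `Literature.RingTheory.KrullDimension.ringKrullDim_quotient_add_one_le` — for a non-zero prime `𝔭` of a domain `A`,
  `dim (A ⧸ 𝔭) + 1 ≤ dim A`; with the above, `trdeg_F (A ⧸ 𝔭) < trdeg_F A` for affine domains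
  (`Literature.RingTheory.KrullDimension.trdeg_quotient_lt`).

These are the dimension-theoretic inputs for the Zariski dimension `Literature.NumberTheory.Transcendental.zariskiDim` of
subvarieties of affine space used in the transcendence files (`ExpVarieties.lean`).

## References

* H. Matsumura, *Commutative Ring Theory*, Cambridge Studies in Advanced Mathematics 8, CUP
  1986/87 (transl. M. Reid), Thm 5.6 (p. 31), Thm 9.3, Thm 9.4.
* D. Eisenbud, *Commutative Algebra with a View Toward Algebraic Geometry*, GTM 150, Prop. 9.2,
  Thm A (§8, §13), Cor. 13.4.
-/

noncomputable section

open Order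

namespace Literature.RingTheory.KrullDimension

/-! ### Integral extensions: incomparability and going-up for chains -/

section Integral

variable {R S : Type*} [CommRing R] [CommRing S] [Algebra R S] [Algebra.IsIntegral R S]

/-- **Incomparability**: for an integral algebra `S` over `R`, contraction of primes is strictly
monotone, so `dim S ≤ dim R` (Matsumura Thm 9.3 (ii) / Eisenbud Cor. 4.18). [cite: Matsumura1987, Thm 9.3] -/
theorem ringKrullDim_le_of_isIntegral : ringKrullDim S ≤ ringKrullDim R :=
  krullDim_le_of_strictMono (fun P : PrimeSpectrum S => PrimeSpectrum.comap (algebraMap R S) P)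
    fun _ _ h => Ideal.IsIntegral.comap_lt_comap h

/-- **Going-up for chains**: if `R → S` is injective and integral, every strictly increasing chain
of primes of `R` is the contraction of a strictly increasing chain of primes of `S` of the same
length; we record the length and the top of the lifted chain (Matsumura Thm 9.4; the TODO after
`Ideal.exists_ideal_over_prime_of_isIntegral_of_isPrime` in Mathlib). [cite: Matsumura1987, Thm 9.4] -/
theorem exists_ltSeries_of_isIntegral (hinj : Function.Injective (algebraMap R S))
    (p : LTSeries (PrimeSpectrum R)) :
    ∃ q : LTSeries (PrimeSpectrum S), q.length = p.length ∧
      q.last.asIdeal.comap (algebraMap R S) = p.last.asIdeal := by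
  induction p using RelSeries.inductionOn' with
  | singleton P =>
    obtain ⟨Q, -, hQ, hQP⟩ := Ideal.exists_ideal_over_prime_of_isIntegral P.asIdeal (⊥ : Ideal S)
      (by
        rw [← RingHom.ker_eq_comap_bot, (RingHom.injective_iff_ker_eq_bot _).1 hinj]
        exact bot_le)
    exact ⟨RelSeries.singleton _ ⟨Q, hQ⟩, rfl, hQP⟩
  | snoc p P hlt ih =>
    obtain ⟨q, hlen, hlast⟩ := ih
    have hle : q.last.asIdeal.comap (algebraMap R S) ≤ P.asIdeal := by
      rw [hlast]; exact le_of_lt hlt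
    obtain ⟨Q, hQq, hQ, hQP⟩ :=
      Ideal.exists_ideal_over_prime_of_isIntegral P.asIdeal q.last.asIdeal hle
    have hlt' : q.last < ⟨Q, hQ⟩ := by
      refine lt_of_le_of_ne hQq fun h => ?_
      have : q.last.asIdeal.comap (algebraMap R S) = P.asIdeal := by
        rw [h]; exact hQP
      rw [hlast] at this
      exact (ne_of_lt hlt) (PrimeSpectrum.ext this)
    refine ⟨q.snoc ⟨Q, hQ⟩ hlt', ?_, ?_⟩
    · simp [hlen]
    · simpa using hQP

/-- **Integral extensions preserve Krull dimension**: if `R → S` is injective and integral then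
`dim R = dim S` (Matsumura Thm 9.4 with incomparability; Eisenbud Prop. 9.2). [cite: Matsumura1987, Thm 9.4] -/
theorem ringKrullDim_eq_of_isIntegral (hinj : Function.Injective (algebraMap R S)) :
    ringKrullDim R = ringKrullDim S := by
  refine le_antisymm ?_ ringKrullDim_le_of_isIntegral
  refine iSup_le fun p => ?_
  obtain ⟨q, hlen, -⟩ := exists_ltSeries_of_isIntegral hinj p
  rw [← hlen]
  exact LTSeries.length_le_krullDim q

end Integral

/-! ### Affine domains: `dim = trdeg` -/

section Affine

variable (F A : Type*) [Field F] [CommRing A] [IsDomain A] [Algebra F A] [Algebra.FiniteType F A]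

/-- **`dim A = trdeg_F A ∈ ℕ` for affine domains** (Matsumura Thm 5.6; Eisenbud Thm A): by Noether
normalization `A` is integral over a polynomial ring `F[x₁, …, x_s] ⊆ A` on algebraically
independent elements, so `dim A = dim F[x₁, …, x_s] = s`, and `x` is a transcendence basis of
`A` over `F`, so `trdeg_F A = s`. [cite: Matsumura1987, Thm 5.6] -/
theorem exists_ringKrullDim_eq_and_trdeg_eq :
    ∃ s : ℕ, ringKrullDim A = s ∧ Algebra.trdeg F A = s := by
  classical
  obtain ⟨s, g, hinj, hint⟩ := exists_integral_inj_algHom_of_fg F A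
  refine ⟨s, ?_, ?_⟩
  · -- dimension: integral injective extension of `F[X_s]`
    letI alg : Algebra (MvPolynomial (Fin s) F) A := g.toRingHom.toAlgebra
    haveI : Algebra.IsIntegral (MvPolynomial (Fin s) F) A := ⟨fun a => hint a⟩
    have hinj' : Function.Injective (algebraMap (MvPolynomial (Fin s) F) A) := hinj
    rw [← ringKrullDim_eq_of_isIntegral hinj', MvPolynomial.ringKrullDim_of_isNoetherianRing,
      ringKrullDim_eq_zero_of_field, Nat.card_eq_fintype_card, Fintype.card_fin, zero_add]
  · -- transcendence degree: `g ∘ X` is a transcendence basis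
    set x : Fin s → A := fun i => g (MvPolynomial.X i) with hx
    have haeval : MvPolynomial.aeval x = g := MvPolynomial.algHom_ext fun i => by
      simp [x]
    have hind : AlgebraicIndependent F x := by
      rw [algebraicIndependent_iff_injective_aeval, haeval]; exact hinj
    have hrange : Algebra.adjoin F (Set.range x) = g.range := by
      rw [Algebra.adjoin_range_eq_range_aeval, haeval]
    -- `A` is algebraic over `F[x] = range g`, because it is integral over `F[X]` via `g`
    have halg : Algebra.IsAlgebraic (Algebra.adjoin F (Set.range x)) A := by
      rw [hrange]
      have hint' : Algebra.IsIntegral g.range A := by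
        refine ⟨fun a => ?_⟩
        obtain ⟨p, hp, hpa⟩ := hint a
        refine ⟨p.map g.rangeRestrict.toRingHom, hp.map _, ?_⟩
        have hcomp : (algebraMap g.range A).comp g.rangeRestrict.toRingHom = g.toRingHom :=
          RingHom.ext fun _ => rfl
        rw [Polynomial.eval₂_map, hcomp]
        exact hpa
      exact Algebra.IsIntegral.isAlgebraic
    have htb : IsTranscendenceBasis F x := hind.isTranscendenceBasis_iff_isAlgebraic.2 halg
    have := htb.lift_cardinalMk_eq_trdeg
    rw [Cardinal.mk_fin, Cardinal.lift_natCast] at this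
    exact Cardinal.lift_eq_nat_iff.1 this.symm

/-- `dim A = trdeg_F A` for an affine domain, as an equality in `WithBot ℕ∞` with the (finite)
transcendence degree read off through `Cardinal.toNat`. [cite: Matsumura1987, Thm 5.6] -/
theorem ringKrullDim_eq_trdeg :
    ringKrullDim A = (Cardinal.toNat (Algebra.trdeg F A) : WithBot ℕ∞) := by
  obtain ⟨s, hs, ht⟩ := exists_ringKrullDim_eq_and_trdeg_eq F A
  rw [hs, ht, Cardinal.toNat_natCast]

/-- The transcendence degree of an affine domain is finite (a natural number). [cite: Matsumura1987, Thm 5.6] -/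
theorem trdeg_eq_toNat : Algebra.trdeg F A = Cardinal.toNat (Algebra.trdeg F A) := by
  obtain ⟨s, -, ht⟩ := exists_ringKrullDim_eq_and_trdeg_eq F A
  rw [ht, Cardinal.toNat_natCast]

/-- A transcendence basis of an affine domain computes its Krull dimension:
`dim A = #ι` for `x : ι → A` a transcendence basis over `F`. [cite: Matsumura1987, Thm 5.6] -/
theorem ringKrullDim_eq_card_of_isTranscendenceBasis {ι : Type*} [Fintype ι] {x : ι → A}
    (hx : IsTranscendenceBasis F x) : ringKrullDim A = Fintype.card ι := by
  have h := hx.lift_cardinalMk_eq_trdeg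
  rw [Cardinal.mk_fintype, Cardinal.lift_natCast] at h
  rw [ringKrullDim_eq_trdeg F A, Cardinal.lift_eq_nat_iff.1 h.symm, Cardinal.toNat_natCast]

end Affine

/-! ### Quotients by non-zero primes drop the dimension -/

section Quotient

variable {A : Type*} [CommRing A] [IsDomain A]

/-- In a domain, for a non-zero ideal `𝔭 ≠ ⊤`… more precisely for any ideal containing a
non-zero element, `dim (A ⧸ 𝔭) + 1 ≤ dim A` (a chain in `A ⧸ 𝔭` pulls back to a chain of primes
containing `𝔭`, below which `⊥` can be added). [folklore] -/
theorem ringKrullDim_quotient_add_one_le {𝔭 : Ideal A} (h𝔭 : 𝔭 ≠ ⊥) :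
    ringKrullDim (A ⧸ 𝔭) + 1 ≤ ringKrullDim A := by
  obtain ⟨r, hr𝔭, hr0⟩ := 𝔭.ne_bot_iff.1 h𝔭
  have hr : r ∈ nonZeroDivisors A := mem_nonZeroDivisors_of_ne_zero hr0
  have h1 := ringKrullDim_quotient_succ_le_of_nonZeroDivisor hr
  have hle : Ideal.span {r} ≤ 𝔭 := (Ideal.span_singleton_le_iff_mem _).2 hr𝔭
  have h2 : ringKrullDim (A ⧸ 𝔭) ≤ ringKrullDim (A ⧸ Ideal.span {r}) :=
    ringKrullDim_le_of_surjective (Ideal.Quotient.factor hle) (Ideal.Quotient.factor_surjective hle)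
  exact le_trans (add_le_add h2 le_rfl) h1

variable (F : Type*) [Field F] [Algebra F A] [Algebra.FiniteType F A]

/-- **Proper quotients of affine domains have smaller transcendence degree**: for a non-zero
prime `𝔭` of an affine domain `A` over `F`, `trdeg_F (A ⧸ 𝔭) < trdeg_F A`
(`dim (A ⧸ 𝔭) + 1 ≤ dim A` and `dim = trdeg` on both sides). [cite: Matsumura1987, Thm 5.6] -/
theorem trdeg_quotient_lt {𝔭 : Ideal A} [𝔭.IsPrime] (h𝔭 : 𝔭 ≠ ⊥) :
    Algebra.trdeg F (A ⧸ 𝔭) < Algebra.trdeg F A := by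
  haveI : IsDomain (A ⧸ 𝔭) := Ideal.Quotient.isDomain 𝔭
  haveI : Algebra.FiniteType F (A ⧸ 𝔭) := inferInstance
  obtain ⟨s, hs, ht⟩ := exists_ringKrullDim_eq_and_trdeg_eq F (A ⧸ 𝔭)
  obtain ⟨t, hs', ht'⟩ := exists_ringKrullDim_eq_and_trdeg_eq F A
  have h := ringKrullDim_quotient_add_one_le h𝔭
  rw [hs, hs'] at h
  have hst : s + 1 ≤ t := by exact_mod_cast h
  rw [ht, ht']
  exact_mod_cast (Nat.lt_of_succ_le hst)

end Quotient

end Literature.RingTheory.KrullDimension
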